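import Summits.KontsevichZagierPeriods.KontsevichZagierPeriods.Theorems.RootDecompQuadraticDescentEisensteinPairP5

/-!
# Census pair #22 (the ℚ(√−3) pair 4·[□²,1/(3−2N)] ≡ 5·[□²,1/(3−N)], N = u²−uv+v²) and #0 DECIDED in `KZ.relations` by rules 1+2 (route `RootDecompQuadraticDescent`, instances of crux stmt-KontsevichZagierPeriods-28994 / stmt-4280) · part 6/9

Cell `decomp-kz`, lens 6 (decomp-kz-lens-6 g7): `pair22` (NO Stokes; blow-up + conic log band + seven ℚ-rational base substitutions; every piecewise-affine chain certified impossible) and `pair0`; packaged `pairs_decided`, `pairs_descentTwoQ_instances`, `pairs_of_kzDimTwo` BY NAME.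

Source: `HOME/decomp-kz-lens-6/g7/EisensteinPair22.lean` sha256 fdb5e0bbc5a4a341 (1894 l; critic decomp-kz-crit-1 g2 CLEARED 2026-08-30T07:59:44Z, std axioms), split by the landing seat decomp-kz-census-1 g7 (earlier parts as landed; the remainder re-cut smaller to respect the 400-line policy after private dedup copies); the route file is imported only by the last part.  No `sorry`; standard axioms.  References: [cite: KontsevichZagier2001, §1.2].
-/

noncomputable section

open MeasureTheory Set MvPolynomial

namespace Summit.KontsevichZagierPeriods.RootDecompQuadraticDescent.EisensteinPair

open Literature.NumberTheory.Transcendental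
open Literature.NumberTheory.Transcendental.KZ
open Literature.ModelTheory.ExponentialFields (IsSemialgebraic)

-- PRIVATE copy (landed twin elsewhere; dedup.landed): snoc2_zero, snoc2_one, init2_zero, last_one_eq, isSemialgebraicFunOn_coord0, isSemialgebraicFunOn_zero', isSemialgebraicFunOn_one', isSemialgebraic_Δo
/-- `snoc2_zero`: auxiliary theorem of the lens-6 development «eis» (instances of 28994/4280) — see the module docstring; verbatim from the lens file. -/
@[simp] private theorem snoc2_zero (x : Fin 1 → ℝ) (t : ℝ) : (Fin.snoc x t : Fin 2 → ℝ) 0 = x 0 := rfl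

/-- `snoc2_one`: auxiliary theorem of the lens-6 development «eis» (instances of 28994/4280) — see the module docstring; verbatim from the lens file. -/
@[simp] private theorem snoc2_one (x : Fin 1 → ℝ) (t : ℝ) : (Fin.snoc x t : Fin 2 → ℝ) 1 = t := rfl

/-- `init2_zero`: auxiliary theorem of the lens-6 development «eis» (instances of 28994/4280) — see the module docstring; verbatim from the lens file. -/
@[simp] private theorem init2_zero (z : Fin 2 → ℝ) : Fin.init z 0 = z 0 := rfl

/-- `last_one_eq`: auxiliary theorem of the lens-6 development «eis» (instances of 28994/4280) — see the module docstring; verbatim from the lens file. -/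
private theorem last_one_eq : (Fin.last 1 : Fin 2) = 1 := rfl

/-- `isSemialgebraicFunOn_coord0`: auxiliary theorem of the lens-6 development «eis» (instances of 28994/4280) — see the module docstring; verbatim from the lens file. -/
private theorem isSemialgebraicFunOn_coord0 {G : Set (Fin 1 → ℝ)} (hG : IsSemialgebraic ℚ G) :
    IsSemialgebraicFunOn ℚ G fun y : Fin 1 → ℝ => y 0 :=
  (isSemialgebraicFunOn_aeval hG (X 0)).congr fun y _ => by simp

/-- `isSemialgebraicFunOn_zero'`: auxiliary theorem of the lens-6 development «eis» (instances of 28994/4280) — see the module docstring; verbatim from the lens file. -/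
private theorem isSemialgebraicFunOn_zero' {G : Set (Fin 1 → ℝ)} (hG : IsSemialgebraic ℚ G) :
    IsSemialgebraicFunOn ℚ G fun _ : Fin 1 → ℝ => (0 : ℝ) := by
  simpa using isSemialgebraicFunOn_ratCast hG 0

/-- `isSemialgebraicFunOn_one'`: auxiliary theorem of the lens-6 development «eis» (instances of 28994/4280) — see the module docstring; verbatim from the lens file. -/
private theorem isSemialgebraicFunOn_one' {G : Set (Fin 1 → ℝ)} (hG : IsSemialgebraic ℚ G) :
    IsSemialgebraicFunOn ℚ G fun _ : Fin 1 → ℝ => (1 : ℝ) := by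
  simpa using isSemialgebraicFunOn_ratCast hG 1

/-- `isSemialgebraic_Δo`: auxiliary theorem of the lens-6 development «eis» (instances of 28994/4280) — see the module docstring; verbatim from the lens file. -/
private theorem isSemialgebraic_Δo : IsSemialgebraic ℚ Δo :=
  KZlog.isSemialgebraic_band (isSemialgebraicFunOn_zero' isSemialgebraic_Gopen)
    (isSemialgebraicFunOn_coord0 isSemialgebraic_Gopen)

section BlowUp

/-- `isSemialgebraic_So`: auxiliary theorem of the lens-6 development «eis» (instances of 28994/4280) — see the module docstring; verbatim from the lens file. -/
theorem isSemialgebraic_So : IsSemialgebraic ℚ So :=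
  KZlog.isSemialgebraic_band (isSemialgebraicFunOn_zero' isSemialgebraic_Gopen)
    (isSemialgebraicFunOn_one' isSemialgebraic_Gopen)

/-- `mem_Δo`: auxiliary theorem of the lens-6 development «eis» (instances of 28994/4280) — see the module docstring; verbatim from the lens file. -/
private theorem mem_Δo {z : Fin 2 → ℝ} : z ∈ Δo ↔ (0 < z 0 ∧ z 0 < 1) ∧ 0 ≤ z 1 ∧ z 1 ≤ z 0 := by
  rw [Δo, KZlog.mem_band, last_one_eq]; rfl

/-- `mem_So`: auxiliary theorem of the lens-6 development «eis» (instances of 28994/4280) — see the module docstring; verbatim from the lens file. -/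
theorem mem_So {z : Fin 2 → ℝ} : z ∈ So ↔ (0 < z 0 ∧ z 0 < 1) ∧ 0 ≤ z 1 ∧ z 1 ≤ 1 := by
  rw [So, KZlog.mem_band, last_one_eq]; rfl

/-- `Δo_subset`: auxiliary theorem of the lens-6 development «eis» (instances of 28994/4280) — see the module docstring; verbatim from the lens file. -/
theorem Δo_subset : Δo ⊆ Δ₁ := fun z hz => by
  rw [mem_Δo] at hz
  refine ⟨fun i => ?_, hz.2.2⟩
  fin_cases i
  · exact ⟨hz.1.1.le, hz.1.2.le⟩
  · exact ⟨hz.2.1, hz.2.2.trans hz.1.2.le⟩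

/-- `So_subset`: auxiliary theorem of the lens-6 development «eis» (instances of 28994/4280) — see the module docstring; verbatim from the lens file. -/
theorem So_subset : So ⊆ cube 2 := fun z hz => by
  rw [mem_So] at hz
  intro i
  fin_cases i
  · exact ⟨hz.1.1.le, hz.1.2.le⟩
  · exact ⟨hz.2.1, hz.2.2⟩

/-- The two vertical edges `{u = 0} ∪ {u = 1}` are Lebesgue-null. -/
private theorem volume_edges : volume ({z : Fin 2 → ℝ | z 0 = 0} ∪ {z | z 0 = 1}) = 0 := by
  have h0 := KZ.volume_setOf_init_mem_eq_zero (n := 1) (KZ.volume_setOf_last_eq_zero (n := 0) (0 : ℝ))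
  have h1 := KZ.volume_setOf_init_mem_eq_zero (n := 1) (KZ.volume_setOf_last_eq_zero (n := 0) (1 : ℝ))
  exact measure_union_null (measure_mono_null (fun z hz => hz) h0) (measure_mono_null (fun z hz => hz) h1)

/-- `volume_Δ₁_diff_Δo`: auxiliary theorem of the lens-6 development «eis» (instances of 28994/4280) — see the module docstring; verbatim from the lens file. -/
private theorem volume_Δ₁_diff_Δo : volume (Δ₁ \ Δo) = 0 := by
  refine measure_mono_null (fun z hz => ?_) volume_edges
  obtain ⟨⟨hc, hle⟩, h2⟩ := hz
  rw [mem_Δo] at h2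
  have h0 := hc 0
  have h1 := hc 1
  by_contra hne
  simp only [mem_union, mem_setOf_eq, not_or] at hne
  exact h2 ⟨⟨lt_of_le_of_ne h0.1 (Ne.symm hne.1), lt_of_le_of_ne h0.2 hne.2⟩, h1.1, hle⟩

/-- `volume_cube_diff_So`: auxiliary theorem of the lens-6 development «eis» (instances of 28994/4280) — see the module docstring; verbatim from the lens file. -/
theorem volume_cube_diff_So : volume (cube 2 \ So) = 0 := by
  refine measure_mono_null (fun z hz => ?_) volume_edges
  obtain ⟨hc, h2⟩ := hz
  rw [mem_So] at h2
  have h0 := hc 0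
  have h1 := hc 1
  by_contra hne
  simp only [mem_union, mem_setOf_eq, not_or] at hne
  exact h2 ⟨⟨lt_of_le_of_ne h0.1 (Ne.symm hne.1), lt_of_le_of_ne h0.2 hne.2⟩, h1.1, h1.2⟩

/-- The blown-up denominator `3 − μ u²(1 − k + k²) = 3 − μ N(u, uk)`. -/
def Qblow (μ : ℚ) : MvPolynomial (Fin 2) ℚ := 3 - C μ * (X 0 ^ 2 * (1 - X 1 + X 1 ^ 2))

/-- `d/ds (3/(3 − K s²)) = 6Ks/(3 − Ks²)²`. -/
theorem hasDerivAt_psi (K t : ℝ) (hne : 3 - K * t ^ 2 ≠ 0) :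
    HasDerivAt (fun s : ℝ => 3 / (3 - K * s ^ 2)) (6 * K * t / (3 - K * t ^ 2) ^ 2) t := by
  have h1 : HasDerivAt (fun s : ℝ => 3 - K * s ^ 2) (2 * -K * t + 0) t :=
    (hasDerivAt_quad (-K) 0 3 t).congr_of_eventuallyEq (Filter.Eventually.of_forall fun s => by ring)
  exact ((hasDerivAt_const t (3 : ℝ)).div h1 hne).congr_deriv (by ring)

section Mu
variable {μ : ℚ} (hμ : 0 < μ ∧ μ ≤ 2)
include hμ

/-- `Qblow_pos`: auxiliary theorem of the lens-6 development «eis» (instances of 28994/4280) — see the module docstring; verbatim from the lens file. -/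
theorem Qblow_pos {z : Fin 2 → ℝ} (hz : z ∈ cube 2) : 0 < aeval z (Qblow μ) := by
  have h0 := hz 0; have h1 := hz 1
  simp only [Qblow, map_sub, map_mul, map_add, map_pow, map_ofNat, map_one, aeval_C, aeval_X, eq_ratCast]
  rw [show (3 : ℝ) - μ * (z 0 ^ 2 * (1 - z 1 + z 1 ^ 2)) =
      3 - μ * (z 0 ^ 2 - z 0 * (z 0 * z 1) + (z 0 * z 1) ^ 2) by ring]
  exact three_sub_pos hμ h0.1 h0.2 (mul_nonneg h0.1 h1.1) (by nlinarith [h0.1, h0.2, h1.1, h1.2])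

/-- `[□², u/(3 − μu²(1−k+k²))]` — the blow-up `y = u·k` of `[Δ₁, 1/(3 − μN(u,y))]`. -/
def Tblow : RFun 2 := ⟨X 0, Qblow μ, fun _ hz => (Qblow_pos hμ hz).ne'⟩

/-- `[Δ°, 1/(3 − μN)]`. -/
def rLowo : IntegralRep 2 := (Tfin hμ).rep.restrict Δo isSemialgebraic_Δo fun _ hz => (Δo_subset hz).1
/-- `[S°, u/(3 − μu²q(k))]`. -/
def rSo : IntegralRep 2 := (Tblow hμ).rep.restrict So isSemialgebraic_So fun _ hz => So_subset hz

/-- Null move: `[Δ₁, T] ≡ [Δ°, T]`. -/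
theorem rLow_rLowo : KZ.of (rLow (Tfin hμ)) - KZ.of (rLowo hμ) ∈ KZ.relations :=
  of_sub_of_mem_relations_of_null _ _ volume_Δ₁_diff_Δo
    (by rw [show (rLowo hμ).domain \ (rLow (Tfin hμ)).domain = ∅ from sdiff_eq_empty.mpr Δo_subset]
        exact measure_empty)
    fun _ _ => rfl

/-- The blow-up `(u, k) ↦ (u, u·k)` of the corner: `[S°, u/(3 − μu²q(k))] ≡ [Δ°, 1/(3 − μN(u,y))]`
(affine fibre substitution over the open base `0 < u < 1`, Jacobian `u`). -/
theorem rSo_rLowo : KZ.of (rSo hμ) - KZ.of (rLowo hμ) ∈ KZ.relations := by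
  refine of_sub_of_mem_relations_of_affine isOpen_Gopen (α := fun _ => 0) (β := fun y => y 0)
    (a := fun _ => 0) (b := fun _ => 1) (a' := fun _ => 0) (b' := fun y => y 0)
    (isSemialgebraicFunOn_zero' isSemialgebraic_Gopen) (isSemialgebraicFunOn_coord0 isSemialgebraic_Gopen)
    (differentiableOn_const _)
    (fun y _ => (hasFDerivAt_apply (𝕜 := ℝ) (0 : Fin 1) y).differentiableAt.differentiableWithinAt)
    (fun y hy => hy.1) (rSo hμ) (rLowo hμ) rfl rfl (fun y _ => by simp) (fun y _ => by simp) fun z hz => ?_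
  show (Tblow hμ).fn z = (Tfin hμ).fn (Fin.snoc (Fin.init z) (0 + Fin.init z 0 * z (Fin.last 1))) * Fin.init z 0
  rw [last_one_eq]
  simp only [RFun.fn, Tblow, Tfin, Qblow, Qfin, map_sub, map_mul, map_add, map_pow, map_ofNat, map_one,
    aeval_C, aeval_X, eq_ratCast, snoc2_zero, snoc2_one, init2_zero, zero_add]
  ring

/-- Null move: `[□², u/(3 − μu²q(k))] ≡ [S°, u/(3 − μu²q(k))]`. -/
theorem Tblow_rSo : KZ.of (Tblow hμ).rep - KZ.of (rSo hμ) ∈ KZ.relations :=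
  IntegralRep.of_sub_of_restrict_mem_relations _ isSemialgebraic_So So_subset volume_cube_diff_So

/-- Relabelling `u ↔ k`. -/
theorem Tblow_swap :
    KZ.of (Tblow hμ).rep - KZ.of ((Tblow hμ).rename (Equiv.swap 0 1)).rep ∈ KZ.relations :=
  RFun.rel_rename _ _

/-- `den_swap_pos`: auxiliary theorem of the lens-6 development «eis» (instances of 28994/4280) — see the module docstring; verbatim from the lens file. -/
theorem den_swap_pos {z : Fin 2 → ℝ} (hz : z ∈ cube 2) : 0 < 3 - (μ : ℝ) * qf (z 0) * z 1 ^ 2 := by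
  have h := Qblow_pos hμ (show z ∘ Equiv.swap 0 1 ∈ cube 2 from fun i => hz _)
  simp only [Qblow, map_sub, map_mul, map_add, map_pow, map_ofNat, map_one, aeval_C, aeval_X, eq_ratCast,
    Function.comp_apply, Equiv.swap_apply_left, Equiv.swap_apply_right] at h
  simp only [qf]
  linarith

end Mu

end BlowUp

end Summit.KontsevichZagierPeriods.RootDecompQuadraticDescent.EisensteinPair

end
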